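import Literature.NumberTheory.LFunctions.Zhang2022.DHMenuConsistentProof
import Literature.NumberTheory.LFunctions.Zhang2022.DHMenuConsistentPrimesProof
import Literature.NumberTheory.LFunctions.Zhang2022.DHMenuConsistentInformal
import Literature.NumberTheory.LFunctions.Zhang2022.DHMenuConsistentInformalCritLine

/-!
# Zhang (2022), rung F-S3, family B-dh — the B-dh CERTIFICATE OF RECORD as ONE kernel theorem:
# `MenuConsistent ∧ MenuConsistentPrimes ∧ MenuInformalConsistent ∧ MenuInformalCritLineConsistent`

Y. Zhang, *Discrete mean estimates and the Landau–Siegel zero*, arXiv:2211.02515v1 [Zhang2022LandauSiegel] — an unrefereed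
manuscript under adjudication. **The programme SEARCHES and TYPES; no claim about Landau–Siegel zeros, Theorems 1–2 of
arXiv:2211.02515 or a repaired Margin232 until a kernel theorem says so.** Nothing in this file is a statement about a
Dirichlet `L`-function: all four conjuncts are statements about the cell's explicit CONSISTENCY WORLD `DH.world D χ`
(`DHChainBarrier`, p461081/p461386: abstract zero/value/prime-count DATA), and this file only CONJOINS four theorems already
in the tree. Cell `landau-siegel` (pub/landau-siegel/), sub-cells B-dh / E; asked by the family planner ls-Bdh-plan g2
(INBOX 2026-08-27T00:23:23Z (b)) as the single declaration B-dh/DESIGN-MAP-dh.md cites; written by ls-Bdh-typer-1 g3.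

## The one theorem

`Zhang2022.DH.certificate_holds : MenuConsistent ∧ MenuConsistentPrimes ∧ MenuInformalConsistent ∧ MenuInformalCritLineConsistent`,
by the anonymous constructor over

1. `menuConsistent_holds` (`DHMenuConsistentProof`, p468827; REF-E verdict 31, E-18 PASS) — E-057 = dhE-24: the (A)-world
   meets every row of the kernel-typed menu `M_typed` (`ZeroWorld.Menu`: rows (A), dhE-01–06, 08–13, 15, 19, S1–S4) for every
   `log D ≥ 43 250`;
2. `menuConsistentPrimes_holds` (`DHMenuConsistentPrimesProof`, p473947; REF-E E-18b PASS) — E-055 = dhE-22 + S5/S6: the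
   prime-side companion menu `M_primes` (`ZeroWorld.MenuPrimes`, `DHChainBarrierPrimes` p464158);
3. `menuInformalConsistent_holds` (`DHMenuConsistentInformal`, p475376; REF-E E-18c PASS as COMPANION) — the typed
   zero-density / zero-free rows of `M_informal`: dhE-07 `thornerZaman2024PNTAP_theorem7_repulsive`, dhE-28
   `motohashi1977_theoremII`, `BGTZ2025.corollary12`, `Kadiri2018.dirichlet_atMostOneZero`, existential constants chosen ONCE
   before `∀ D`;
4. `menuInformalCritLineConsistent_holds` (`DHMenuConsistentInformalCritLine`, p476879) — the typed critical-line rows of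
   `M_informal` (dhE-14): `conreyIwaniecSoundararajanCriticalZeros_theorem1`, `sono2025_theorem11`, `wu2019_theorem2`,
   thresholds Skolemised before `∀ D`.

## Scope (verbatim status of record; this file moves no word)

WORD OF RECORD = conjuncts 1–2: «KILL(B-dh) inside Σ_menu», UNCONDITIONAL over `M_typed ∪ M_primes` = the whole kernel-typed
menu (director-frontier g6 2026-08-26T19:31:07Z and 21:20:22Z (2); ls-lead g2 23:14:29Z (i); REF-B3 blocks 7 + 9;
`Repair.doneCondition_v11`/`_v12` carry `MenuConsistent ∧ MenuConsistentPrimes`, and `_v12` (p477398) also conjunct 3).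
Conjuncts 3–4 = the `M_informal` COMPANIONS, OUTSIDE the word's scope (director term (i); B-dh/KILL-draft.md v1.4.5
3fef880895ed21b9 §1): they say that the typed part of `M_informal` is met by the SAME world, nothing more. Whether
`Repair.doneCondition_v13` absorbs conjunct 4 is ls-barrier-plan's call (`RepairDoneCondition`), not this file's.
NOT covered by any conjunct (B-dh/EDLIST.md v1.6.1; BARRIER-STATE §2′ N8): the untyped `M_informal` rows dhE-18 (ii)
(Granville–Soundararajan 2006 §7 Thm 3 (ii); `W`'s value field is `LOne ∈ {λ, 1}` by design) and dhE-20 (Selberg 1946,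
context row), and designs with a different main-term calculus (OBJECTIVE (O5)).

«The programme SEARCHES and TYPES; no claim about Landau–Siegel zeros, Theorems 1–2 of arXiv:2211.02515 or a repaired
Margin232 until a kernel theorem says so.»

## References

* [Zhang2022LandauSiegel] Y. Zhang, *Discrete mean estimates and the Landau–Siegel zero*, arXiv:2211.02515v1 (2022), §2
  Assumption (A).
* The four proof modules imported above (their module docstrings carry the row ↔ tree-decl tables and the sources:
  [BenliGoelTwissZaman2025], [ThornerZaman2024LogFree], [ThornerZaman2024PNTAP], [BennettMartinOBryantRechnitzer2021],
  [Motohashi1977], [Kadiri2018], [ConreyIwaniecSoundararajan2013CriticalZeros], [Sono2025], [Wu2019]).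
* pub/landau-siegel/B-dh/KILL-draft.md v1.4.5 §1; B-dh/DESIGN-MAP-dh.md v1.5.1; barrier/BARRIER-STATE.md §2′ N8.
-/

namespace Literature.NumberTheory.LFunctions.Zhang2022.DH

/-- **The B-dh certificate of record, one theorem.** Conjuncts 1–2 (`MenuConsistent`, `MenuConsistentPrimes`) = the word
of record «KILL(B-dh) inside Σ_menu», unconditional over `M_typed ∪ M_primes` (director-frontier g6 19:31:07Z / 21:20:22Z
(2), ls-lead g2 23:14:29Z (i)); conjuncts 3–4 (`MenuInformalConsistent`, `MenuInformalCritLineConsistent`) = the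
`M_informal` COMPANIONS, OUTSIDE the word's scope (term (i), KILL-draft v1.4.5 §1). Every conjunct is a statement about the
consistency world `DH.world D χ` (abstract data), proved in the imported modules (p468827, p473947, p475376, p476879); this
decl only conjoins them. «The programme SEARCHES and TYPES; no claim about Landau–Siegel zeros, Theorems 1–2 of
arXiv:2211.02515 or a repaired Margin232 until a kernel theorem says so.» [cite: Zhang2022LandauSiegel, §2 Assumption (A)] -/
theorem certificate_holds :
    MenuConsistent ∧ MenuConsistentPrimes ∧ MenuInformalConsistent ∧ MenuInformalCritLineConsistent :=
  ⟨menuConsistent_holds, menuConsistentPrimes_holds, menuInformalConsistent_holds, menuInformalCritLineConsistent_holds⟩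

end Literature.NumberTheory.LFunctions.Zhang2022.DH
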